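import Summits.ValiantsHypothesis.ValiantsHypothesis.Theorems.KPlusLogSqLawTropicalBMarkedEdgeCommonPath
import Summits.ValiantsHypothesis.ValiantsHypothesis.Theorems.KPlusLogSqLawTropicalBMarkedEdgeExchange

/-!
# Route «KPlusLogSqLaw», crux `TropicalB` (stmt-ValiantsHypothesis-19771) — MARKED-EDGE sector, FOUR-BIT LAW, part 4:
# THE MARKED-EDGE FOUR-BIT LAW (abstract cover form, every finite node set, arbitrary support and weights)

HONEST FRAMING.  Helper file (cell `pub-symmetroid`, seat val-sym-trop-p4 (g16), 2026-08-28; `--supports stmt-ValiantsHypothesis-19771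
--as helper`).  Fourth file of the kernel version of the lineage's «MARKED-EDGE FOUR-BIT LAW» (g15 THEOREM-FOURBIT.md §1–§2): the theorem
itself, in the abstract cover setting of part 3 (the reading in the tree's `IsDominant` currency is part 5).  A structure theorem of ONE
sector (one marked loop per positive slope); nothing here concerns general designs, `TropicalB` in its window, `WeakLifting`, the doors,
`MatrixDescartes` (stmt-ValiantsHypothesis-18050) or VP ≠ VNP.

SETTING (inline).  Nodes `V` (finite); covers `σ : Equiv.Perm V`; arc presence `ok`, arc weights `w : V → V → ℤ`; arc SLOPES `g` that
live on loops only (`g i j = 0` for `j ≠ i`) and are non-negative (`0 ≤ g i i`); four MARKED nodes `b₀, b₁, b₂, b₃` with loop slopes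
`g b₀ b₀ < g b₁ b₁ < g b₂ b₂` and `g b₁ b₁ + g b₂ b₂ < g b₃ b₃` (e.g. `1, 2, 4, 8`, or `2^i < 2^j < 2^k < 2^l`); every OTHER node with a
non-zero loop slope is a CONTEXT node: the four covers below agree on whether they use its loop.  Score at `θ`:
`∑ i, (w i (σ i) + θ * g i (σ i))`; «unique maximiser at `θ`» as in part 3.

**THEOREM `four_bit_law`.**  There are no parameters `θD, θA, θB, θC` and covers `D, A, B, C`, unique maximisers there, with the loop
patterns `D ⊇ {b₀,b₁,b₂} ∌ b₃`, `A ∋ b₀, b₃ ∌ b₁, b₂`, `B ∋ b₁, b₃ ∌ b₀, b₂`, `C ∋ b₂, b₃ ∌ b₀, b₁` («bit 3 alone OFF» and «bit 3 ON with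
exactly one low bit»).  No order of the `θ`'s is assumed (it is derived), no tie-freeness, any number of auxiliary nodes.
PROOF = parts 1–3: slopes force `θD < θA < θB < θC`; the pair exchange makes `D⁻¹A, D⁻¹B, D⁻¹C` single cycles; the triple exchange gives
the pairwise «no third cover» property (slope domination by a pigeonhole on the bits `b₃` and `b₁`/`b₂`); `order_contradiction` ends it.
-/

set_option linter.dupNamespace false
set_option autoImplicit false

namespace Summit.ValiantsHypothesis.ValiantsHypothesis.Theorems.KPlusLogSqLaw
namespace MarkedEdge
namespace FourBit

open Finset

variable {V : Type*} [Fintype V] [DecidableEq V]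

/-- A sum supported on three points. [folklore] -/
theorem sum_eq_three {f : V → ℤ} {b₁ b₂ b₃ : V} (h12 : b₁ ≠ b₂) (h13 : b₁ ≠ b₃) (h23 : b₂ ≠ b₃)
    (hz : ∀ i, i ≠ b₁ → i ≠ b₂ → i ≠ b₃ → f i = 0) : ∑ i, f i = f b₁ + f b₂ + f b₃ := by
  rw [← Finset.sum_subset (Finset.subset_univ ({b₁, b₂, b₃} : Finset V))]
  · rw [Finset.sum_insert (by simp [h12, h13]), Finset.sum_pair h23, add_assoc]
  · intro i _ hi
    simp only [Finset.mem_insert, Finset.mem_singleton, not_or] at hi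
    exact hz i hi.1 hi.2.1 hi.2.2

omit [DecidableEq V] in
/-- **Parameters increase with slopes.**  If `X` is the unique maximiser at `θX`, `Y` at `θY`, and the slope of `Y` exceeds that of
`X`, then `θX < θY`. [folklore: convexity of the upper envelope] -/
theorem theta_lt (ok : V → V → Prop) (w g : V → V → ℤ) {θX θY : ℤ} {X Y : Equiv.Perm V}
    (hX : (∀ i, ok i (X i)) ∧ ∀ τ : Equiv.Perm V, τ ≠ X → (∀ i, ok i (τ i)) →
      ∑ i, (w i (τ i) + θX * g i (τ i)) < ∑ i, (w i (X i) + θX * g i (X i)))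
    (hY : (∀ i, ok i (Y i)) ∧ ∀ τ : Equiv.Perm V, τ ≠ Y → (∀ i, ok i (τ i)) →
      ∑ i, (w i (τ i) + θY * g i (τ i)) < ∑ i, (w i (Y i) + θY * g i (Y i)))
    (hslope : (∑ i, g i (X i)) < ∑ i, g i (Y i)) : θX < θY := by
  have hne : Y ≠ X := by rintro rfl; exact lt_irrefl _ hslope
  have h1 := score_lt_of_isMax ok w g hX hY.1 hne
  have h2 := score_lt_of_isMax ok w g hY hX.1 (Ne.symm hne)
  by_contra h
  push Not at h
  have key : 0 ≤ (θX - θY) * ((∑ i, g i (Y i)) - ∑ i, g i (X i)) := mul_nonneg (by linarith) (by linarith)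
  have ek : (θX - θY) * ((∑ i, g i (Y i)) - ∑ i, g i (X i))
      = θX * (∑ i, g i (Y i)) - θX * (∑ i, g i (X i)) - θY * (∑ i, g i (Y i)) + θY * (∑ i, g i (X i)) := by ring
  linarith

omit [Fintype V] in
/-- Value of a loop-supported slope on an arc. [folklore] -/
theorem g_apply_eq (g : V → V → ℤ) (hoff : ∀ i j, j ≠ i → g i j = 0) (σ : Equiv.Perm V) (i : V) :
    g i (σ i) = if σ i = i then g i i else 0 := by
  split_ifs with h
  · rw [h]
  · exact hoff i (σ i) h

/-- **Slope gap for a pair `(D, X)`.**  If `D` misses the loop at `b₃`, `X` uses it, and every other loop of non-zero slope used by `X`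
is used by `D`, then a cover built from arcs of `D` and `X` has slope `≤ slope D` (if it misses the loop at `b₃`) or `≥ slope X` (if it
uses it). [this seat's lemma] -/
theorem pair_gap (g : V → V → ℤ) (hoff : ∀ i j, j ≠ i → g i j = 0) (hnn : ∀ i, 0 ≤ g i i)
    {b₃ : V} {D X F : Equiv.Perm V} (hD3 : D b₃ ≠ b₃) (hX3 : X b₃ = b₃)
    (hctx : ∀ i, i ≠ b₃ → g i i ≠ 0 → X i = i → D i = i) (hF : ∀ i, F i = D i ∨ F i = X i) :
    (∑ i, g i (F i)) ≤ (∑ i, g i (D i)) ∨ (∑ i, g i (X i)) ≤ ∑ i, g i (F i) := by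
  by_cases hF3 : F b₃ = b₃
  · right
    refine Finset.sum_le_sum fun i _ => ?_
    rw [g_apply_eq g hoff X i, g_apply_eq g hoff F i]
    by_cases hXi : X i = i
    · rw [if_pos hXi]
      by_cases hi3 : i = b₃
      · subst hi3; rw [if_pos hF3]
      · by_cases hgi : g i i = 0
        · rw [hgi]; split_ifs <;> exact le_rfl
        · have hDi : D i = i := hctx i hi3 hgi hXi
          have hFi : F i = i := by rcases hF i with h | h; exacts [h.trans hDi, h.trans hXi]
          rw [if_pos hFi]
    · rw [if_neg hXi]; split_ifs; exacts [hnn i, le_rfl]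
  · left
    refine Finset.sum_le_sum fun i _ => ?_
    rw [g_apply_eq g hoff D i, g_apply_eq g hoff F i]
    by_cases hFi : F i = i
    · rw [if_pos hFi]
      by_cases hDi : D i = i
      · rw [if_pos hDi]
      · rw [if_neg hDi]
        have hi3 : i ≠ b₃ := fun h => hF3 (h ▸ hFi)
        have hXi : X i = i := by
          rcases hF i with h | h
          · exact absurd (h.symm.trans hFi) hDi
          · exact h.symm.trans hFi
        by_contra hpos
        exact hDi (hctx i hi3 (fun h0 => hpos (by rw [h0])) hXi)
    · rw [if_neg hFi]; split_ifs; exacts [hnn i, le_rfl]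

/-- **Low factor.**  In a triple `(D, X, Y)` with `D` missing the loop at `b₃` and every other loop of non-zero slope used by `X` or
`Y` used by `D`, a cover inside their arcs that misses the loop at `b₃` has slope `≤ slope D`. [this seat's lemma] -/
theorem low_factor (g : V → V → ℤ) (hoff : ∀ i j, j ≠ i → g i j = 0) (hnn : ∀ i, 0 ≤ g i i) {b₃ : V} {D X Y F : Equiv.Perm V}
    (hctx : ∀ i, i ≠ b₃ → g i i ≠ 0 → D i ≠ i → X i ≠ i ∧ Y i ≠ i)
    (hF : ∀ i, F i = D i ∨ F i = X i ∨ F i = Y i) (hF3 : F b₃ ≠ b₃) :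
    (∑ i, g i (F i)) ≤ ∑ i, g i (D i) := by
  refine Finset.sum_le_sum fun i _ => ?_
  rw [g_apply_eq g hoff D i, g_apply_eq g hoff F i]
  by_cases hFi : F i = i
  · rw [if_pos hFi]
    by_cases hDi : D i = i
    · rw [if_pos hDi]
    · rw [if_neg hDi]
      have hi3 : i ≠ b₃ := fun h => hF3 (h ▸ hFi)
      by_contra hpos
      have hg : g i i ≠ 0 := fun h0 => hpos (by rw [h0])
      obtain ⟨hXi, hYi⟩ := hctx i hi3 hg hDi
      rcases hF i with h | h | h
      · exact hDi (h ▸ hFi)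
      · exact hXi (h ▸ hFi)
      · exact hYi (h ▸ hFi)
  · rw [if_neg hFi]; split_ifs; exacts [hnn i, le_rfl]

/-- **High factor.**  In a triple `(D, X, Y)`: a cover inside their arcs using the loops at `b₃` and at `bk`, where every OTHER loop
of non-zero slope used by `Y` is used by `D` and `X` as well, has slope `≥ slope Y`. [this seat's lemma] -/
theorem high_factor (g : V → V → ℤ) (hoff : ∀ i j, j ≠ i → g i j = 0) (hnn : ∀ i, 0 ≤ g i i) {b₃ bk : V}
    {D X Y F : Equiv.Perm V} (hctx : ∀ i, i ≠ b₃ → i ≠ bk → g i i ≠ 0 → Y i = i → D i = i ∧ X i = i)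
    (hF : ∀ i, F i = D i ∨ F i = X i ∨ F i = Y i) (hF3 : F b₃ = b₃) (hFk : F bk = bk) :
    (∑ i, g i (Y i)) ≤ ∑ i, g i (F i) := by
  refine Finset.sum_le_sum fun i _ => ?_
  rw [g_apply_eq g hoff Y i, g_apply_eq g hoff F i]
  by_cases hYi : Y i = i
  · rw [if_pos hYi]
    by_cases hi3 : i = b₃
    · subst hi3; rw [if_pos hF3]
    by_cases hik : i = bk
    · subst hik; rw [if_pos hFk]
    by_cases hgi : g i i = 0
    · rw [hgi]; split_ifs <;> exact le_rfl
    · obtain ⟨hDi, hXi⟩ := hctx i hi3 hik hgi hYi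
      have hFi : F i = i := by
        rcases hF i with h | h | h; exacts [h.trans hDi, h.trans hXi, h.trans hYi]
      rw [if_pos hFi]
  · rw [if_neg hYi]; split_ifs; exacts [hnn i, le_rfl]

/-- Pigeonhole on two pairs among three. [folklore] -/
theorem two_two_of_three {p₁ p₂ p₃ q₁ q₂ q₃ : Prop} [Decidable p₁] [Decidable p₂] [Decidable p₃] [Decidable q₁]
    [Decidable q₂] [Decidable q₃]
    (hp : (if p₁ then 1 else 0) + (if p₂ then 1 else 0) + (if p₃ then 1 else 0) = (2 : ℕ))
    (hq : (if q₁ then 1 else 0) + (if q₂ then 1 else 0) + (if q₃ then 1 else 0) = (2 : ℕ)) :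
    ((p₁ ∧ q₁) ∨ (p₂ ∧ q₂) ∨ (p₃ ∧ q₃)) ∧ (¬ p₁ ∨ ¬ p₂ ∨ ¬ p₃) := by
  by_cases h1 : p₁ <;> by_cases h2 : p₂ <;> by_cases h3 : p₃ <;> by_cases k1 : q₁ <;> by_cases k2 : q₂ <;>
    by_cases k3 : q₃ <;> simp_all

omit [Fintype V] [DecidableEq V] in
/-- Arcs of a factor are arcs of the three covers. [folklore] -/
theorem arcs_of_perm {σ₁ σ₂ σ₃ F₁ F₂ F₃ : Equiv.Perm V} (hP : ∀ i, List.Perm [F₁ i, F₂ i, F₃ i] [σ₁ i, σ₂ i, σ₃ i]) :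
    (∀ i, F₁ i = σ₁ i ∨ F₁ i = σ₂ i ∨ F₁ i = σ₃ i) ∧ (∀ i, F₂ i = σ₁ i ∨ F₂ i = σ₂ i ∨ F₂ i = σ₃ i) ∧
    (∀ i, F₃ i = σ₁ i ∨ F₃ i = σ₂ i ∨ F₃ i = σ₃ i) := by
  have mem : ∀ i x, x ∈ [F₁ i, F₂ i, F₃ i] → x = σ₁ i ∨ x = σ₂ i ∨ x = σ₃ i := by
    intro i x hx
    have hx' := (hP i).mem_iff.mp hx
    simpa only [List.mem_cons, List.not_mem_nil, or_false] using hx'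
  exact ⟨fun i => mem i _ (by simp), fun i => mem i _ (by simp), fun i => mem i _ (by simp)⟩

omit [Fintype V] in
/-- Indicator count of a loop across a factorisation. [folklore] -/
theorem loop_count {σ₁ σ₂ σ₃ F₁ F₂ F₃ : Equiv.Perm V} (hP : ∀ i, List.Perm [F₁ i, F₂ i, F₃ i] [σ₁ i, σ₂ i, σ₃ i]) (b : V) :
    (if F₁ b = b then 1 else 0) + (if F₂ b = b then 1 else 0) + (if F₃ b = b then 1 else 0)
      = (if σ₁ b = b then (1 : ℕ) else 0) + (if σ₂ b = b then 1 else 0) + (if σ₃ b = b then 1 else 0) := by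
  have := ((hP b).map fun x => if x = b then (1 : ℕ) else 0).sum_eq
  simpa [add_assoc] using this

/-- **Slope domination for a triple `(D, X, Y)`** (the hypothesis `hcomb` of `no_third_cover`): `D` misses the loop at `b₃`, `X, Y`
use it; `D, Y` use the loop at `bk`, `X` does not; context as in `low_factor` / `high_factor`.  Then every factorisation has a factor
of slope `≤ slope D` and ANOTHER of slope `≥ slope Y` (pigeonhole: two factors use `b₃`, two use `bk`, one misses `b₃`).
[this seat's lemma] -/
theorem slope_domination (g : V → V → ℤ) (hoff : ∀ i j, j ≠ i → g i j = 0) (hnn : ∀ i, 0 ≤ g i i)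
    {b₃ bk : V} {D X Y : Equiv.Perm V} (hD3 : D b₃ ≠ b₃) (hX3 : X b₃ = b₃) (hY3 : Y b₃ = b₃)
    (hDk : D bk = bk) (hXk : X bk ≠ bk) (hYk : Y bk = bk)
    (hctx₁ : ∀ i, i ≠ b₃ → g i i ≠ 0 → D i ≠ i → X i ≠ i ∧ Y i ≠ i)
    (hctx₂ : ∀ i, i ≠ b₃ → i ≠ bk → g i i ≠ 0 → Y i = i → D i = i ∧ X i = i)
    (F₁ F₂ F₃ : Equiv.Perm V) (hP : ∀ i, List.Perm [F₁ i, F₂ i, F₃ i] [D i, X i, Y i]) :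
    ((∑ i, g i (F₁ i)) ≤ (∑ i, g i (D i)) ∧ (∑ i, g i (Y i)) ≤ ∑ i, g i (F₂ i)) ∨
    ((∑ i, g i (F₁ i)) ≤ (∑ i, g i (D i)) ∧ (∑ i, g i (Y i)) ≤ ∑ i, g i (F₃ i)) ∨
    ((∑ i, g i (F₂ i)) ≤ (∑ i, g i (D i)) ∧ (∑ i, g i (Y i)) ≤ ∑ i, g i (F₁ i)) ∨
    ((∑ i, g i (F₂ i)) ≤ (∑ i, g i (D i)) ∧ (∑ i, g i (Y i)) ≤ ∑ i, g i (F₃ i)) ∨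
    ((∑ i, g i (F₃ i)) ≤ (∑ i, g i (D i)) ∧ (∑ i, g i (Y i)) ≤ ∑ i, g i (F₁ i)) ∨
    ((∑ i, g i (F₃ i)) ≤ (∑ i, g i (D i)) ∧ (∑ i, g i (Y i)) ≤ ∑ i, g i (F₂ i)) := by
  obtain ⟨a₁, a₂, a₃⟩ := arcs_of_perm hP
  have c3 := loop_count hP b₃
  have ck := loop_count hP bk
  rw [if_neg hD3, if_pos hX3, if_pos hY3] at c3
  rw [if_pos hDk, if_neg hXk, if_pos hYk] at ck
  have c3' : (if F₁ b₃ = b₃ then 1 else 0) + (if F₂ b₃ = b₃ then 1 else 0) + (if F₃ b₃ = b₃ then 1 else 0) = (2 : ℕ) := by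
    rw [c3]
  have ck' : (if F₁ bk = bk then 1 else 0) + (if F₂ bk = bk then 1 else 0) + (if F₃ bk = bk then 1 else 0) = (2 : ℕ) := by
    rw [ck]
  obtain ⟨hhi, hlo⟩ := two_two_of_three c3' ck'
  have lo := fun (F : Equiv.Perm V) (hF : ∀ i, F i = D i ∨ F i = X i ∨ F i = Y i) (h3 : F b₃ ≠ b₃) =>
    low_factor g hoff hnn hctx₁ hF h3
  have hi := fun (F : Equiv.Perm V) (hF : ∀ i, F i = D i ∨ F i = X i ∨ F i = Y i) (h3 : F b₃ = b₃) (hk : F bk = bk) =>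
    high_factor g hoff hnn hctx₂ hF h3 hk
  rcases hhi with ⟨p, q⟩ | ⟨p, q⟩ | ⟨p, q⟩ <;> rcases hlo with n | n | n
  · exact absurd p n
  · exact Or.inr (Or.inr (Or.inl ⟨lo F₂ a₂ n, hi F₁ a₁ p q⟩))
  · exact Or.inr (Or.inr (Or.inr (Or.inr (Or.inl ⟨lo F₃ a₃ n, hi F₁ a₁ p q⟩))))
  · exact Or.inl ⟨lo F₁ a₁ n, hi F₂ a₂ p q⟩
  · exact absurd p n
  · exact Or.inr (Or.inr (Or.inr (Or.inr (Or.inr ⟨lo F₃ a₃ n, hi F₂ a₂ p q⟩))))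
  · exact Or.inr (Or.inl ⟨lo F₁ a₁ n, hi F₃ a₃ p q⟩)
  · exact Or.inr (Or.inr (Or.inr (Or.inl ⟨lo F₂ a₂ n, hi F₃ a₃ p q⟩)))
  · exact absurd p n

/-- **THE MARKED-EDGE FOUR-BIT LAW (abstract cover form, every finite node set).**  Arc slopes on loops only and non-negative;
marked nodes `b₀, b₁, b₂, b₃` with loop slopes `g b₀ b₀ < g b₁ b₁ < g b₂ b₂`, `g b₁ b₁ + g b₂ b₂ < g b₃ b₃`; every other node of
non-zero loop slope used alike by `D, A, B, C` (CONTEXT).  Then covers `D, A, B, C` with the loop patterns «`b₀,b₁,b₂` but not `b₃`»,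
«`b₀,b₃` but not `b₁,b₂`», «`b₁,b₃` but not `b₀,b₂`», «`b₂,b₃` but not `b₀,b₁`» are NOT all unique maximisers — at any parameters,
for any arc predicate `ok` and any arc weights `w`.  No order of the parameters and no tie-freeness is assumed.
[this seat's theorem = THEOREM-FOURBIT.md §1 (general form), kernel version; proof = parts 1–3] -/
theorem four_bit_law (ok : V → V → Prop) (w g : V → V → ℤ) (hoff : ∀ i j, j ≠ i → g i j = 0) (hnn : ∀ i, 0 ≤ g i i)
    {b₀ b₁ b₂ b₃ : V} (hs01 : g b₀ b₀ < g b₁ b₁) (hs12 : g b₁ b₁ < g b₂ b₂) (hs3 : g b₁ b₁ + g b₂ b₂ < g b₃ b₃)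
    {D A B C : Equiv.Perm V}
    (hD0 : D b₀ = b₀) (hD1 : D b₁ = b₁) (hD2 : D b₂ = b₂) (hD3 : D b₃ ≠ b₃)
    (hA0 : A b₀ = b₀) (hA1 : A b₁ ≠ b₁) (hA2 : A b₂ ≠ b₂) (hA3 : A b₃ = b₃)
    (hB0 : B b₀ ≠ b₀) (hB1 : B b₁ = b₁) (hB2 : B b₂ ≠ b₂) (hB3 : B b₃ = b₃)
    (hC0 : C b₀ ≠ b₀) (hC1 : C b₁ ≠ b₁) (hC2 : C b₂ = b₂) (hC3 : C b₃ = b₃)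
    (hctx : ∀ i, i ≠ b₀ → i ≠ b₁ → i ≠ b₂ → i ≠ b₃ → g i i ≠ 0 → (A i = i ↔ D i = i) ∧ (B i = i ↔ D i = i) ∧ (C i = i ↔ D i = i))
    {θD θA θB θC : ℤ}
    (hD : (∀ i, ok i (D i)) ∧ ∀ τ : Equiv.Perm V, τ ≠ D → (∀ i, ok i (τ i)) →
      ∑ i, (w i (τ i) + θD * g i (τ i)) < ∑ i, (w i (D i) + θD * g i (D i)))
    (hA : (∀ i, ok i (A i)) ∧ ∀ τ : Equiv.Perm V, τ ≠ A → (∀ i, ok i (τ i)) →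
      ∑ i, (w i (τ i) + θA * g i (τ i)) < ∑ i, (w i (A i) + θA * g i (A i)))
    (hB : (∀ i, ok i (B i)) ∧ ∀ τ : Equiv.Perm V, τ ≠ B → (∀ i, ok i (τ i)) →
      ∑ i, (w i (τ i) + θB * g i (τ i)) < ∑ i, (w i (B i) + θB * g i (B i)))
    (hC : (∀ i, ok i (C i)) ∧ ∀ τ : Equiv.Perm V, τ ≠ C → (∀ i, ok i (τ i)) →
      ∑ i, (w i (τ i) + θC * g i (τ i)) < ∑ i, (w i (C i) + θC * g i (C i))) : False := by
  -- distinctness of the marked nodes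
  have h0 := hnn b₀
  have h01 : b₀ ≠ b₁ := fun h => hA1 (h ▸ hA0)
  have h02 : b₀ ≠ b₂ := fun h => hA2 (h ▸ hA0)
  have h03 : b₀ ≠ b₃ := fun h => hD3 (h ▸ hD0)
  have h12 : b₁ ≠ b₂ := fun h => hB2 (h ▸ hB1)
  have h13 : b₁ ≠ b₃ := fun h => hD3 (h ▸ hD1)
  have h23 : b₂ ≠ b₃ := fun h => hD3 (h ▸ hD2)
  have hg := g_apply_eq g hoff
  -- away from the marked nodes the four covers use the same loops, hence the same slope contributions
  have ctxD : ∀ (X : Equiv.Perm V), (∀ i, i ≠ b₀ → i ≠ b₁ → i ≠ b₂ → i ≠ b₃ → g i i ≠ 0 → (X i = i ↔ D i = i)) →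
      ∀ i, i ≠ b₀ → i ≠ b₁ → i ≠ b₂ → i ≠ b₃ → g i (X i) - g i (D i) = 0 := by
    intro X hX i n0 n1 n2 n3
    rw [hg X i, hg D i]
    by_cases hgi : g i i = 0
    · rw [hgi]; split_ifs <;> simp
    · have := hX i n0 n1 n2 n3 hgi
      by_cases hDi : D i = i
      · rw [if_pos hDi, if_pos (this.mpr hDi)]; ring
      · rw [if_neg hDi, if_neg (fun h => hDi (this.mp h))]; ring
  -- slope differences against `D`
  have sA : (∑ i, g i (A i)) - ∑ i, g i (D i) = g b₃ b₃ - g b₁ b₁ - g b₂ b₂ := by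
    have key : ∑ i, (g i (A i) - g i (D i))
        = (g b₁ (A b₁) - g b₁ (D b₁)) + (g b₂ (A b₂) - g b₂ (D b₂)) + (g b₃ (A b₃) - g b₃ (D b₃)) := by
      refine sum_eq_three h12 h13 h23 fun i n1 n2 n3 => ?_
      by_cases hi0 : i = b₀
      · subst hi0; rw [hg A, hg D, if_pos hA0, if_pos hD0]; ring
      · exact ctxD A (fun i a b c d e => (hctx i a b c d e).1) i hi0 n1 n2 n3
    rw [← Finset.sum_sub_distrib, key, hg A b₁, hg A b₂, hg A b₃, hg D b₁, hg D b₂, hg D b₃, if_neg hA1, if_neg hA2, if_pos hA3,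
      if_pos hD1, if_pos hD2, if_neg hD3]; ring
  have sB : (∑ i, g i (B i)) - ∑ i, g i (D i) = g b₃ b₃ - g b₀ b₀ - g b₂ b₂ := by
    have key : ∑ i, (g i (B i) - g i (D i))
        = (g b₀ (B b₀) - g b₀ (D b₀)) + (g b₂ (B b₂) - g b₂ (D b₂)) + (g b₃ (B b₃) - g b₃ (D b₃)) := by
      refine sum_eq_three h02 h03 h23 fun i n0 n2 n3 => ?_
      by_cases hi1 : i = b₁
      · subst hi1; rw [hg B, hg D, if_pos hB1, if_pos hD1]; ring
      · exact ctxD B (fun i a b c d e => (hctx i a b c d e).2.1) i n0 hi1 n2 n3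
    rw [← Finset.sum_sub_distrib, key, hg B b₀, hg B b₂, hg B b₃, hg D b₀, hg D b₂, hg D b₃, if_neg hB0, if_neg hB2, if_pos hB3,
      if_pos hD0, if_pos hD2, if_neg hD3]; ring
  have sC : (∑ i, g i (C i)) - ∑ i, g i (D i) = g b₃ b₃ - g b₀ b₀ - g b₁ b₁ := by
    have key : ∑ i, (g i (C i) - g i (D i))
        = (g b₀ (C b₀) - g b₀ (D b₀)) + (g b₁ (C b₁) - g b₁ (D b₁)) + (g b₃ (C b₃) - g b₃ (D b₃)) := by
      refine sum_eq_three h01 h03 h13 fun i n0 n1 n3 => ?_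
      by_cases hi2 : i = b₂
      · subst hi2; rw [hg C, hg D, if_pos hC2, if_pos hD2]; ring
      · exact ctxD C (fun i a b c d e => (hctx i a b c d e).2.2) i n0 n1 hi2 n3
    rw [← Finset.sum_sub_distrib, key, hg C b₀, hg C b₁, hg C b₃, hg D b₀, hg D b₁, hg D b₃, if_neg hC0, if_neg hC1, if_pos hC3,
      if_pos hD0, if_pos hD1, if_neg hD3]; ring
  -- the parameters are ordered like the slopes
  have tDA : θD < θA := theta_lt ok w g hD hA (by linarith)
  have tDB : θD < θB := theta_lt ok w g hD hB (by linarith)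
  have tAB : θA < θB := theta_lt ok w g hA hB (by linarith)
  have tAC : θA < θC := theta_lt ok w g hA hC (by linarith)
  have tBC : θB < θC := theta_lt ok w g hB hC (by linarith)
  -- context in the shapes used by the slope lemmas
  have cp : ∀ (X : Equiv.Perm V), (∀ i, i ≠ b₀ → i ≠ b₁ → i ≠ b₂ → i ≠ b₃ → g i i ≠ 0 → (X i = i ↔ D i = i)) →
      ∀ i, i ≠ b₃ → g i i ≠ 0 → X i = i → D i = i := by
    intro X hX i n3 hgi hXi
    by_cases hi0 : i = b₀
    · rw [hi0]; exact hD0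
    by_cases hi1 : i = b₁
    · rw [hi1]; exact hD1
    by_cases hi2 : i = b₂
    · rw [hi2]; exact hD2
    exact (hX i hi0 hi1 hi2 n3 hgi).mp hXi
  have cpA := cp A (fun i a b c d e => (hctx i a b c d e).1)
  have cpB := cp B (fun i a b c d e => (hctx i a b c d e).2.1)
  have cpC := cp C (fun i a b c d e => (hctx i a b c d e).2.2)
  have low : ∀ (X Y : Equiv.Perm V), (∀ i, i ≠ b₃ → g i i ≠ 0 → X i = i → D i = i) →
      (∀ i, i ≠ b₃ → g i i ≠ 0 → Y i = i → D i = i) → ∀ i, i ≠ b₃ → g i i ≠ 0 → D i ≠ i → X i ≠ i ∧ Y i ≠ i :=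
    fun X Y hX hY i n3 hgi hDi => ⟨fun h => hDi (hX i n3 hgi h), fun h => hDi (hY i n3 hgi h)⟩
  have highAB : ∀ i, i ≠ b₃ → i ≠ b₁ → g i i ≠ 0 → B i = i → D i = i ∧ A i = i := by
    intro i n3 n1 hgi hBi
    by_cases hi0 : i = b₀
    · exact absurd hBi (by rw [hi0]; exact hB0)
    by_cases hi2 : i = b₂
    · exact absurd hBi (by rw [hi2]; exact hB2)
    have hc := hctx i hi0 n1 hi2 n3 hgi
    exact ⟨hc.2.1.mp hBi, hc.1.mpr (hc.2.1.mp hBi)⟩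
  have highXC : ∀ (X : Equiv.Perm V), (∀ i, i ≠ b₀ → i ≠ b₁ → i ≠ b₂ → i ≠ b₃ → g i i ≠ 0 → (X i = i ↔ D i = i)) →
      ∀ i, i ≠ b₃ → i ≠ b₂ → g i i ≠ 0 → C i = i → D i = i ∧ X i = i := by
    intro X hX i n3 n2 hgi hCi
    by_cases hi0 : i = b₀
    · exact absurd hCi (by rw [hi0]; exact hC0)
    by_cases hi1 : i = b₁
    · exact absurd hCi (by rw [hi1]; exact hC1)
    have hc := hctx i hi0 hi1 n2 n3 hgi
    exact ⟨hc.2.2.mp hCi, (hX i hi0 hi1 n2 n3 hgi).mpr (hc.2.2.mp hCi)⟩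
  -- pair exchange: the relative permutations are cycles
  have cycA : (D⁻¹ * A).IsCycle :=
    isCycle_of_pair ok w g tDA (fun h => hA1 (h ▸ hD1)) hD hA fun F hF => pair_gap g hoff hnn hD3 hA3 cpA hF
  have cycB : (D⁻¹ * B).IsCycle :=
    isCycle_of_pair ok w g tDB (fun h => hB0 (h ▸ hD0)) hD hB fun F hF => pair_gap g hoff hnn hD3 hB3 cpB hF
  have cycC : (D⁻¹ * C).IsCycle :=
    isCycle_of_pair ok w g (tDA.trans tAC) (fun h => hC0 (h ▸ hD0)) hD hC fun F hF => pair_gap g hoff hnn hD3 hC3 cpC hF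
  -- triple exchange: no third cover
  have TAB := no_third_cover ok w g tDA tAB hD hA hB
    (slope_domination g hoff hnn hD3 hA3 hB3 hD1 hA1 hB1 (low A B cpA cpB) highAB)
  have TAC := no_third_cover ok w g tDA tAC hD hA hC
    (slope_domination g hoff hnn hD3 hA3 hC3 hD2 hA2 hC2 (low A C cpA cpC)
      (highXC A fun i a b c d e => (hctx i a b c d e).1))
  have TBC := no_third_cover ok w g tDB tBC hD hB hC
    (slope_domination g hoff hnn hD3 hB3 hC3 hD2 hB2 hC2 (low B C cpB cpC)
      (highXC B fun i a b c d e => (hctx i a b c d e).2.1))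
  -- relative form of «no third cover»
  have rel : ∀ (X Y : Equiv.Perm V), (∀ R : Equiv.Perm V, (∀ i, R i = D i ∨ R i = X i ∨ R i = Y i) → R = D ∨ R = X ∨ R = Y) →
      ∀ ρ : Equiv.Perm V, (∀ i, ρ i = i ∨ ρ i = (D⁻¹ * X) i ∨ ρ i = (D⁻¹ * Y) i) →
        ρ = 1 ∨ ρ = D⁻¹ * X ∨ ρ = D⁻¹ * Y := by
    intro X Y hT ρ hρ
    have hR : ∀ i, (D * ρ) i = D i ∨ (D * ρ) i = X i ∨ (D * ρ) i = Y i := by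
      intro i
      rcases hρ i with h | h | h
      · exact Or.inl (by rw [Equiv.Perm.mul_apply, h])
      · exact Or.inr (Or.inl (by rw [Equiv.Perm.mul_apply, h]; simp))
      · exact Or.inr (Or.inr (by rw [Equiv.Perm.mul_apply, h]; simp))
    rcases hT (D * ρ) hR with h | h | h
    · exact Or.inl (by simpa using congrArg (fun τ => D⁻¹ * τ) h)
    · exact Or.inr (Or.inl (by simpa using congrArg (fun τ => D⁻¹ * τ) h))
    · exact Or.inr (Or.inr (by simpa using congrArg (fun τ => D⁻¹ * τ) h))
  have fx : ∀ (X : Equiv.Perm V) (i : V), (D⁻¹ * X) i = i ↔ X i = D i := by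
    intro X i; rw [Equiv.Perm.mul_apply, Equiv.Perm.inv_eq_iff_eq]
  exact order_contradiction (D⁻¹ * A) (D⁻¹ * B) (D⁻¹ * C) cycA cycB cycC
    ((fx A b₀).mpr (hA0.trans hD0.symm)) (fun h => hA1 (((fx A b₁).mp h).trans hD1))
    (fun h => hA2 (((fx A b₂).mp h).trans hD2)) (fun h => hD3 (((fx A b₃).mp h).symm.trans hA3))
    ((fx B b₁).mpr (hB1.trans hD1.symm)) (fun h => hB0 (((fx B b₀).mp h).trans hD0))
    (fun h => hB2 (((fx B b₂).mp h).trans hD2)) (fun h => hD3 (((fx B b₃).mp h).symm.trans hB3))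
    ((fx C b₂).mpr (hC2.trans hD2.symm)) (fun h => hC0 (((fx C b₀).mp h).trans hD0))
    (fun h => hC1 (((fx C b₁).mp h).trans hD1)) (fun h => hD3 (((fx C b₃).mp h).symm.trans hC3))
    (rel A B TAB) (rel A C TAC) (rel B C TBC)

end FourBit
end MarkedEdge
end Summit.ValiantsHypothesis.ValiantsHypothesis.Theorems.KPlusLogSqLaw
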